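import Summits.BirchSwinnertonDyer.BirchSwinnertonDyer.Theorems.ClassRecordThreeEulerHalvesAtThreeCartanSupplyVirtualSupply
import HarnessLib

/-!
# VIRTUAL REALISATION over a cyclotomic field, I — monomial representations and the Frobenius trace formula

Helper file riding `--supports stmt-BirchSwinnertonDyer-19109` (crux `EulerHalvesAtThree`; UNREGISTERED sub-line `Cruxes/EulerHalvesAtThree/Lines/cartan_corr`,
seat `bsd-idea-10` g13). The engine `CartanSupply.convolutionAt_of_virtual` (file X, `…CartanSupplyVirtualSupply`) accepts representations over ANY field
of characteristic zero, and NORM ONE is the tree theorem `NormOne.sum_sq_eq_card`; so SUPPLY needs no descent to `ℚ`, only an honest realisation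
`χ_W = χ_A − χ_B` over SOME field per prime. Files «VIRTUAL REALISATION I–V» build it MONOMIALLY over `ℚ(ζ_{3q})`. THIS FILE (generic, any finite
group `Γ`, subgroup `H ≤ Γ`, multiplicative character `θ : H →* k`):
* §1 `wPermOp w π` — the weighted permutation operator `F ↦ (i ↦ w i · F (π i))` on `ι → k` and its trace `Σ_{π i = i} w i` (`trace_wPermOp`);
* §2 `wt H θ` — `θ` extended by zero to `Γ`, conjugation-invariant under `H` (`wt_conj`);
* §3 `monRep H θ : Representation k Γ (Γ ⧸ H → k)` — the MONOMIAL (induced) representation `Ind_H^Γ θ` realised on functions on `Γ ⧸ H` with the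
  automorphy factor `θ((s c)⁻¹ · g · s(g⁻¹c))` for the section `s = Quotient.out` (`cocycle_mem`, `monRep_apply`);
* §4 its character: `χ(g) = Σ_{c} wt((s c)⁻¹ g (s c))` (`monRep_character`) and the FROBENIUS FORMULA
  `|H| · χ(g) = Σ_{x ∈ Γ} wt(x⁻¹ g x) = |C_Γ(g)| · Σ_{y ∈ cl(g)} wt y` (`card_mul_character`, `card_mul_character_eq_classSum`).
HONEST FRAMING: generic finite-group bookkeeping; nothing about NUM, crux 23422 ∕ 19109 or any summit statement is proved by this seat; BSD is proved
for no curve. [folklore; cite: SerreLinearRepresentations1977 §3.3, §7.2]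
-/

set_option linter.dupNamespace false
set_option autoImplicit false

noncomputable section

namespace Summit.BirchSwinnertonDyer.BirchSwinnertonDyer.Theorems.CartanSupply.Monomial

open scoped Classical

/-! ## §1 Weighted permutation operators and their trace -/

section weighted

variable {k : Type*} [CommRing k] {ι : Type*}

/-- The weighted permutation operator `F ↦ (i ↦ w i · F (π i))` on `ι → k`. -/
def wPermOp (w : ι → k) (π : ι → ι) : (ι → k) →ₗ[k] (ι → k) where
  toFun F i := w i * F (π i)
  map_add' F₁ F₂ := by funext i; simp only [Pi.add_apply, mul_add]
  map_smul' c F := by funext i; simp only [Pi.smul_apply, smul_eq_mul, RingHom.id_apply, mul_left_comm]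

/-- PROVED: unfolding. [folklore] -/
theorem wPermOp_apply (w : ι → k) (π : ι → ι) (F : ι → k) (i : ι) : wPermOp w π F i = w i * F (π i) := rfl

/-- PROVED: **the trace of a weighted permutation operator is the sum of the weights over the fixed points.** [folklore] -/
theorem trace_wPermOp [Fintype ι] (w : ι → k) (π : ι → ι) :
    LinearMap.trace k (ι → k) (wPermOp w π) = ∑ i, if π i = i then w i else 0 := by
  rw [LinearMap.trace_eq_matrix_trace k (Pi.basisFun k ι), Matrix.trace]
  refine Finset.sum_congr rfl (fun i _ => ?_)
  rw [Matrix.diag_apply, LinearMap.toMatrix_apply, Pi.basisFun_repr, wPermOp_apply, Pi.basisFun_apply]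
  by_cases h : π i = i
  · rw [if_pos h, h, Pi.single_eq_same, mul_one]
  · rw [if_neg h, Pi.single_eq_of_ne h, mul_zero]

end weighted

/-! ## §2 A character of a subgroup extended by zero -/

section monomial

variable {Γ : Type*} [Group Γ] (H : Subgroup Γ) {k : Type*} [CommRing k] (θ : H →* k)

/-- `θ` extended by zero to the whole group. -/
def wt (y : Γ) : k := if hy : y ∈ H then θ ⟨y, hy⟩ else 0

/-- PROVED: on `H` the weight is `θ`. [folklore] -/
theorem wt_of_mem {y : Γ} (hy : y ∈ H) : wt H θ y = θ ⟨y, hy⟩ := by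
  unfold wt; rw [dif_pos hy]

/-- PROVED: off `H` the weight vanishes. [folklore] -/
theorem wt_of_not_mem {y : Γ} (hy : y ∉ H) : wt H θ y = 0 := by
  unfold wt; rw [dif_neg hy]

/-- PROVED: the weight is multiplicative on `H`. [folklore] -/
theorem wt_mul_of_mem {a b : Γ} (ha : a ∈ H) (hb : b ∈ H) : wt H θ (a * b) = wt H θ a * wt H θ b := by
  rw [wt_of_mem H θ ha, wt_of_mem H θ hb, wt_of_mem H θ (H.mul_mem ha hb), ← map_mul]; rfl

/-- PROVED: `wt 1 = 1`. [folklore] -/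
theorem wt_one : wt H θ 1 = 1 := by
  rw [wt_of_mem H θ H.one_mem]; exact map_one θ

/-- PROVED: **the weight is invariant under conjugation by `H`** (the target `k` is commutative). [folklore] -/
theorem wt_conj (y : Γ) {h : Γ} (hh : h ∈ H) : wt H θ (h⁻¹ * y * h) = wt H θ y := by
  by_cases hy : y ∈ H
  · have hm : h⁻¹ * y * h ∈ H := H.mul_mem (H.mul_mem (H.inv_mem hh) hy) hh
    rw [wt_of_mem H θ hm, wt_of_mem H θ hy]
    have e : (⟨h⁻¹ * y * h, hm⟩ : H) = ⟨h⁻¹, H.inv_mem hh⟩ * ⟨y, hy⟩ * ⟨h, hh⟩ := rfl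
    rw [e, map_mul, map_mul, mul_right_comm, ← map_mul]
    have e2 : (⟨h⁻¹, H.inv_mem hh⟩ : H) * ⟨h, hh⟩ = 1 := by
      apply Subtype.ext
      simp only [Subgroup.coe_mul, inv_mul_cancel, OneMemClass.coe_one]
    rw [e2, map_one, one_mul]
  · have hm : h⁻¹ * y * h ∉ H := by
      intro hm
      apply hy
      have := H.mul_mem (H.mul_mem hh hm) (H.inv_mem hh)
      simpa only [mul_assoc, mul_inv_cancel, mul_one, ← mul_assoc h h⁻¹, one_mul] using this
    rw [wt_of_not_mem H θ hm, wt_of_not_mem H θ hy]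

/-! ## §3 The monomial representation `Ind_H^Γ θ` on `Γ ⧸ H → k` -/

/-- A set-theoretic section of `Γ → Γ ⧸ H`. -/
def sec (c : Γ ⧸ H) : Γ := Quotient.out c

/-- PROVED: `sec` is a section. [folklore] -/
theorem sec_spec (c : Γ ⧸ H) : (((sec H c : Γ)) : Γ ⧸ H) = c := QuotientGroup.out_eq' c

/-- PROVED: `(x : Γ ⧸ H) = (y : Γ ⧸ H)` iff `x⁻¹ y ∈ H` (restated for convenience of rewriting with `sec`). [folklore] -/
theorem sec_inv_mul_mem (x : Γ) : (sec H (QuotientGroup.mk x))⁻¹ * x ∈ H :=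
  QuotientGroup.eq.1 (sec_spec H (QuotientGroup.mk x))

/-- PROVED: **the cocycle lands in `H`**: `(s c)⁻¹ · g · s(g⁻¹ c) ∈ H`. [folklore] -/
theorem cocycle_mem (g : Γ) (c : Γ ⧸ H) : (sec H c)⁻¹ * g * sec H (g⁻¹ • c) ∈ H := by
  have e : ((sec H c : Γ) : Γ ⧸ H) = (((g * sec H (g⁻¹ • c) : Γ)) : Γ ⧸ H) := by
    rw [sec_spec, show g * sec H (g⁻¹ • c) = g • sec H (g⁻¹ • c) from rfl, ← MulAction.Quotient.smul_coe, sec_spec, smul_inv_smul]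
  have h := QuotientGroup.eq.1 e
  rwa [← mul_assoc] at h

/-- The monomial representation `Ind_H^Γ θ`: `(g · F)(c) = θ((s c)⁻¹ g s(g⁻¹ c)) · F(g⁻¹ c)`. -/
def monRep : Representation k Γ (Γ ⧸ H → k) where
  toFun g := wPermOp (fun c => wt H θ ((sec H c)⁻¹ * g * sec H (g⁻¹ • c))) (fun c => g⁻¹ • c)
  map_one' := by
    apply LinearMap.ext; intro F; funext c
    rw [wPermOp_apply, inv_one, one_smul, mul_one, inv_mul_cancel, wt_one, one_mul]
    rfl
  map_mul' g₁ g₂ := by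
    apply LinearMap.ext; intro F; funext c
    rw [wPermOp_apply, Module.End.mul_apply, wPermOp_apply, wPermOp_apply, ← mul_assoc (G := k)]
    have hs : (g₁ * g₂)⁻¹ • c = g₂⁻¹ • (g₁⁻¹ • c) := by rw [mul_inv_rev, mul_smul]
    rw [hs]
    congr 1
    rw [← wt_mul_of_mem H θ (cocycle_mem H g₁ c) (cocycle_mem H g₂ (g₁⁻¹ • c))]
    congr 1
    group

/-- PROVED: unfolding of the action. [folklore] -/
theorem monRep_apply (g : Γ) (F : Γ ⧸ H → k) (c : Γ ⧸ H) :
    monRep H θ g F c = wt H θ ((sec H c)⁻¹ * g * sec H (g⁻¹ • c)) * F (g⁻¹ • c) := rfl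

/-! ## §4 The character and the Frobenius formula -/

/-- PROVED: the conjugation weight `x ↦ wt(x⁻¹ g x)` only depends on the coset `xH`. [folklore] -/
theorem wt_conj_eq_sec (g x : Γ) : wt H θ (x⁻¹ * g * x) = wt H θ ((sec H (x : Γ ⧸ H))⁻¹ * g * sec H (x : Γ ⧸ H)) := by
  have hm := sec_inv_mul_mem H x
  set s := sec H (x : Γ ⧸ H)
  have e : x⁻¹ * g * x = (s⁻¹ * x)⁻¹ * (s⁻¹ * g * s) * (s⁻¹ * x) := by group
  rw [e, wt_conj H θ _ hm]

/-- PROVED: a coset fixed by `g` has `s(c)⁻¹ g s(c) ∈ H`, and conversely. [folklore] -/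
theorem smul_eq_iff_mem (g : Γ) (c : Γ ⧸ H) : g⁻¹ • c = c ↔ (sec H c)⁻¹ * g * sec H c ∈ H := by
  constructor
  · intro h
    have := cocycle_mem H g c
    rwa [h] at this
  · intro h
    rw [mul_assoc] at h
    have e : ((sec H c : Γ) : Γ ⧸ H) = (((g * sec H c : Γ)) : Γ ⧸ H) := QuotientGroup.eq.2 h
    rw [sec_spec, show g * sec H c = g • sec H c from rfl, ← MulAction.Quotient.smul_coe, sec_spec] at e
    conv_lhs => rw [e]
    exact inv_smul_smul g c

variable [Fintype Γ]

/-- PROVED — **the character of the monomial representation**: `χ(g) = Σ_c wt((s c)⁻¹ g (s c))` (the non-fixed cosets contribute `0`). [folklore] -/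
theorem monRep_character {k : Type*} [Field k] (θ : H →* k) (g : Γ) :
    (monRep H θ).character g = ∑ c : Γ ⧸ H, wt H θ ((sec H c)⁻¹ * g * sec H c) := by
  unfold Representation.character
  rw [show monRep H θ g = wPermOp (fun c => wt H θ ((sec H c)⁻¹ * g * sec H (g⁻¹ • c))) (fun c => g⁻¹ • c) from rfl, trace_wPermOp]
  refine Finset.sum_congr rfl (fun c _ => ?_)
  by_cases h : g⁻¹ • c = c
  · rw [if_pos h, h]
  · rw [if_neg h, wt_of_not_mem H θ (fun hm => h ((smul_eq_iff_mem H g c).2 hm))]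

/-- PROVED: every fibre of `Γ → Γ ⧸ H` has `|H|` elements. [folklore] -/
theorem card_fibre (c : Γ ⧸ H) : (Finset.univ.filter fun x : Γ => (x : Γ ⧸ H) = c).card = Nat.card H := by
  rw [Nat.card_eq_fintype_card, ← Fintype.card_coe]
  refine Fintype.card_congr
    { toFun := fun x => ⟨(sec H c)⁻¹ * x.1, QuotientGroup.eq.1 (by rw [sec_spec, (Finset.mem_filter.1 x.2).2])⟩
      invFun := fun h => ⟨sec H c * h.1, Finset.mem_filter.2 ⟨Finset.mem_univ _, by rw [QuotientGroup.mk_mul_of_mem _ h.2, sec_spec]⟩⟩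
      left_inv := fun x => Subtype.ext (by simp only [mul_inv_cancel_left])
      right_inv := fun h => Subtype.ext (by simp only [inv_mul_cancel_left]) }

/-- PROVED — **FROBENIUS, first form**: `|H| · χ(g) = Σ_{x ∈ Γ} wt(x⁻¹ g x)`. [folklore] -/
theorem card_mul_character {k : Type*} [Field k] (θ : H →* k) (g : Γ) :
    (Nat.card H : k) * (monRep H θ).character g = ∑ x : Γ, wt H θ (x⁻¹ * g * x) := by
  rw [monRep_character, Finset.mul_sum]
  symm
  rw [← Finset.sum_fiberwise_of_maps_to (s := Finset.univ) (t := Finset.univ) (g := fun x : Γ => (x : Γ ⧸ H)) (fun _ _ => Finset.mem_univ _)]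
  refine Finset.sum_congr rfl (fun c _ => ?_)
  rw [Finset.sum_congr rfl (fun x hx => by rw [wt_conj_eq_sec H θ g x, (Finset.mem_filter.1 hx).2]), Finset.sum_const, card_fibre,
    nsmul_eq_mul]

/-- PROVED: the transporter count `#{x : x⁻¹ g x = y}` is `|C_Γ(g)|` for `y` in the class of `g`. [folklore] -/
theorem card_transporter_eq (g y x₀ : Γ) (h : x₀⁻¹ * g * x₀ = y) :
    (Finset.univ.filter fun x : Γ => x⁻¹ * g * x = y).card = (Finset.univ.filter fun x : Γ => x⁻¹ * g * x = g).card := by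
  refine Finset.card_equiv (Equiv.mulRight x₀⁻¹) (fun x => ?_)
  simp only [Finset.mem_filter, Finset.mem_univ, true_and, Equiv.coe_mulRight, ← h]
  constructor
  · intro hx
    calc (x * x₀⁻¹)⁻¹ * g * (x * x₀⁻¹) = x₀ * (x⁻¹ * g * x) * x₀⁻¹ := by group
      _ = x₀ * (x₀⁻¹ * g * x₀) * x₀⁻¹ := by rw [hx]
      _ = g := by group
  · intro hx
    calc x⁻¹ * g * x = x₀⁻¹ * ((x * x₀⁻¹)⁻¹ * g * (x * x₀⁻¹)) * x₀ := by group
      _ = x₀⁻¹ * g * x₀ := by rw [hx]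

/-- PROVED — **FROBENIUS, class form**: `|H| · χ(g) = |C_Γ(g)| · Σ_{y ∈ cl(g)} wt(y)`. [folklore] -/
theorem card_mul_character_eq_classSum {k : Type*} [Field k] (θ : H →* k) (g : Γ) :
    (Nat.card H : k) * (monRep H θ).character g =
      ((Finset.univ.filter fun x : Γ => x⁻¹ * g * x = g).card : k) *
        ∑ y ∈ Finset.univ.filter (fun y : Γ => ∃ x : Γ, x⁻¹ * g * x = y), wt H θ y := by
  rw [card_mul_character, Finset.sum_comp (s := Finset.univ) (wt H θ) (fun x : Γ => x⁻¹ * g * x), Finset.mul_sum]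
  have himg : Finset.univ.image (fun x : Γ => x⁻¹ * g * x) = Finset.univ.filter (fun y : Γ => ∃ x : Γ, x⁻¹ * g * x = y) := by
    ext y; simp only [Finset.mem_image, Finset.mem_univ, true_and, Finset.mem_filter]
  rw [himg]
  refine Finset.sum_congr rfl (fun y hy => ?_)
  obtain ⟨x₀, hx₀⟩ := (Finset.mem_filter.1 hy).2
  rw [nsmul_eq_mul, card_transporter_eq g y x₀ hx₀]

end monomial

end Summit.BirchSwinnertonDyer.BirchSwinnertonDyer.Theorems.CartanSupply.Monomial

end
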